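import Mathlib.LinearAlgebra.Matrix.ToLin
import Mathlib.LinearAlgebra.Matrix.Basis
import Mathlib.LinearAlgebra.Matrix.Invertible
import Mathlib.LinearAlgebra.Basis.VectorSpace
import Mathlib.LinearAlgebra.FiniteDimensional.Lemmas
import Literature.NumberTheory.Transcendental.RoyPadicRankThm5Proofs
import Literature.Barriers.Schanuel.AlgebraicIndependenceOfLogarithmsThm4Proofs
import HarnessLib

/-!
# Roy 1992, §4: Corollary 1 for `K = ℚ̄_p` PROVED from Theorem 4 (the printed deduction, p. 38)

Second proof companion of `Literature/NumberTheory/Transcendental/RoyPadicRank.lean` (after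
`RoyPadicRankThm5Proofs.lean`, Theorem 4 ⇒ Theorem 5), which vendors, for
the `p`-adic field `K = ℚ̄_p = PadicAlgCl p` (`ℚ̄ = padicQbar p`, `𝓛̃ = RoyPadic.logLinearForms p`),
Roy's Theorem 4 (`roy1992_padic_thm4`) and Corollary 1 (`roy1992_padic_cor1`) as named facts and
proves Corollary 1 ⇒ Corollary 2 (`roy1992_padic_strongSixExponentials_of_cor1`). This file proves
the next printed link of the chain, **Theorem 4 ⇒ Corollary 1**
(`roy1992_padic_cor1_of_thm4`), a line-by-line port to `ℚ̄_p` of the tree's complex-case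
deduction `Literature.Barriers.Schanuel.roy1992_cor1_of_thm4`
(`Literature/Barriers/Schanuel/AlgebraicIndependenceOfLogarithmsThm4Proofs.lean`); hence also
Theorem 4 ⇒ Corollary 2 (`roy1992_padic_strongSixExponentials_of_thm4`). Everything here is a
theorem; no definition, no named fact is introduced. What remains below Corollary 1 is exactly the
named fact `roy1992_padic_thm4` (Roy's Theorem 4 for `ℚ̄_p`), which in print rests on Theorem 2 and
on M. Waldschmidt's Theorem 1 (Theorem 4.1 of [W3] over `ℂ_p`).

## What the source prints [Roy1992, §4, p. 38]

"COROLLARY 1. Let `M` be a matrix with coefficients in `𝓛̃`, of size `d × l` with `d, l > 0`, and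
let `n` be its rank. We have `n ≥ θ̃(M)·d/(1 + θ̃(M))`.
Proof. Let `φ : K^l → K^d` be the `K`-linear mapping given by `φ(x) = Mx` for all `x ∈ K^l`. We put
`Z = φ(ℚ̄^l)` and `U = K·Z = φ(K^l)`. Then `d`, `Z`, and `U` fulfill the conditions of Theorem 4.
Since `dim_K(U) = n`, this theorem asserts the existence of a surjective `K`-linear mapping
`t : K^d → K^{d'}` which is rational over `ℚ̄`, and which, letting `l' = dim_ℚ̄(t(Z))`, satisfies
`n ≥ l'd/(d' + l')`. (7) Since `t` is surjective and rational over `ℚ̄`, there exists a basis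
`(u₁, …, u_d)` of `K^d` over `K`, made of elements of `ℚ̄^d`, whose `d − d'` last elements form a
basis of `ker(t)` over `K`. Since `Z' = (t ∘ φ)(ℚ̄^l)` is of dimension `l'` over `ℚ̄`, there also
exists a basis `(v₁, …, v_l)` of `K^l` over `K`, made of elements of `ℚ̄^l`, whose `l − l'` last
elements belong to `ker(t ∘ φ)`. Relative to these bases of `K^d` and `K^l`, the matrix of `φ` can
be written as a lower triangular block matrix `(M' 0; N N')`, with `M'` of size `d' × l'`. Since `M`
is the matrix of `φ` with respect to the canonical bases of `K^d` and `K^l`, and since the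
base-change matrices have their coefficients in `ℚ̄`, this implies `θ̃(M) ≤ l'/d'`. The announced
inequality follows from this upper bound combined with (7)."

## Lean rendering (same lemma order as the complex-case file)

* the two adapted bases of the printed proof are packaged as `P ∈ GL_d(ℚ̄)`, `Q ∈ GL_l(ℚ̄)` by the
  field-generic lemmas of the complex-case file, REUSED by import (not re-declared):
  `Literature.Barriers.Schanuel.exists_isUnit_rows_eq` (an independent family is the top rows of an
  invertible matrix) and `Literature.Barriers.Schanuel.exists_isUnit_cols_mem` (a `k`-dimensional
  subspace contains the last `k` columns of an invertible matrix), and likewise the monotonicity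
  of `x ↦ xd/(1 + x)` (`Literature.Barriers.Schanuel.mul_div_one_add_mono`);
* a minimising rational surjection exists (the ratio `dim t(U)/d'` takes finitely many values),
  so that the named fact `roy1992_padic_thm4`, stated for every minimising `t`, can be applied:
  `RoyPadic.exists_minimal_rationalMap` and `RoyPadic.toMatrix'_mem_of_isRationalMap` of the
  sibling `Literature/NumberTheory/Transcendental/RoyPadicRankThm5Proofs.lean` (Theorem 4 ⇒
  Theorem 5), imported;
* `RoyPadic.isBlockCouple_of_rationalMap` — the base change: `(d', l')`, `l' = dim_ℚ̄ t(Z)`, is an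
  admissible couple for `θ̃(M)`, whence `θ̃(M) ≤ l'/d'` (`RoyPadic.thetaBar_le_div`);
* `roy1992_padic_cor1_of_thm4` — (7) from Theorem 4 with `Z = ` the `ℚ̄`-span and `U = ` the
  `K`-span of the columns of `M` (`dim_K U = rank M`), combined with `θ̃(M) ≤ l'/d'` through the
  monotonicity of `x ↦ xd/(1 + x)`.

## References

* [Roy1992] D. Roy, *Matrices whose coefficients are linear forms in logarithms*, J. Number
  Theory 41 (1992) 22–47: Notations (p. 24); §4 Theorem 4 (p. 34); definition of `θ̃` (p. 37);
  Corollary 1 and its proof, Corollary 2 (p. 38).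
-/

noncomputable section

open Module

namespace Literature.NumberTheory.Transcendental

namespace RoyPadic

variable {p : ℕ} [Fact p.Prime]

/-! ### `Z = φ(ℚ̄^l)` and `U = φ(K^l)`: the spans of the columns of `M` -/

section Block

variable {d l : ℕ}

/-- `dim_K U = rank M` for `U = φ(K^l)`, the `K`-span of the columns of `M`.
[cite: Roy1992, §4 proof of Corollary 1 (p. 38)] -/
theorem finrank_span_col (M : Matrix (Fin d) (Fin l) (PadicAlgCl p)) :
    finrank (PadicAlgCl p) (Submodule.span (PadicAlgCl p) (Set.range M.col)) = M.rank :=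
  (Matrix.rank_eq_finrank_span_cols M).symm

/-- `Z = φ(ℚ̄^l)`, the `ℚ̄`-span of the columns of `M`, is finite-dimensional over `ℚ̄`. [folklore] -/
theorem finite_span_col (M : Matrix (Fin d) (Fin l) (PadicAlgCl p)) :
    Module.Finite (padicQbar p) (Submodule.span (padicQbar p) (Set.range M.col)) :=
  Module.Finite.span_of_finite _ (Set.finite_range _)

/-- `Z ⊆ U`. [folklore] -/
theorem span_col_le_restrictScalars (M : Matrix (Fin d) (Fin l) (PadicAlgCl p)) :
    Submodule.span (padicQbar p) (Set.range M.col) ≤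
      (Submodule.span (PadicAlgCl p) (Set.range M.col)).restrictScalars (padicQbar p) :=
  Submodule.span_le_restrictScalars _ _ _

/-- If the entries of `M` lie in `𝓛̃` then `Z ⊆ 𝓛̃^d`. [cite: Roy1992, §4 proof of Corollary 1 (p. 38)] -/
theorem mem_logLinearForms_of_mem_span_col {M : Matrix (Fin d) (Fin l) (PadicAlgCl p)}
    (hM : ∀ i j, M i j ∈ logLinearForms p) {z : Fin d → PadicAlgCl p}
    (hz : z ∈ Submodule.span (padicQbar p) (Set.range M.col)) (i : Fin d) :
    z i ∈ logLinearForms p := by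
  have hle : Submodule.span (padicQbar p) (Set.range M.col) ≤
      Submodule.pi Set.univ (fun _ : Fin d => logLinearForms p) := by
    refine Submodule.span_le.2 ?_
    rintro _ ⟨j, rfl⟩
    exact fun i _ => hM i j
  exact hle hz i (Set.mem_univ i)

/-- `t(Z)` is the `ℚ̄`-span of the vectors `t(M.col j)`. [folklore] -/
theorem map_span_col_eq {d' : ℕ} (M : Matrix (Fin d) (Fin l) (PadicAlgCl p))
    (t : (Fin d → PadicAlgCl p) →ₗ[PadicAlgCl p] (Fin d' → PadicAlgCl p)) :
    (Submodule.span (padicQbar p) (Set.range M.col)).map (t.restrictScalars (padicQbar p)) =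
      Submodule.span (padicQbar p) (Set.range fun j => t (M.col j)) := by
  rw [Submodule.map_span, ← Set.range_comp]
  rfl

/-! ### The block form furnished by a rational surjection (the base change of the printed proof) -/

/-- **The admissible couple furnished by a rational surjection**: if `t : K^d → K^{d'}` (`d' > 0`)
is surjective and rational over `ℚ̄`, and `l' = dim_ℚ̄ t(Z)` where `Z` is the `ℚ̄`-span of the
columns of `M`, then `(d', l')` is admissible for `θ̃(M)`: with `P ∈ GL_d(ℚ̄)` whose first `d'`
rows are the rows of the matrix of `t` ("a basis `(u₁, …, u_d)` of `K^d` made of elements of `ℚ̄^d`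
whose `d − d'` last elements form a basis of `ker(t)`", in dual form) and `Q ∈ GL_l(ℚ̄)` whose last
`l − l'` columns lie in the kernel of `x ↦ t(Mx)` on `ℚ̄^l` ("a basis `(v₁, …, v_l)` of `K^l` made
of elements of `ℚ̄^l` whose `l − l'` last elements belong to `ker(t ∘ φ)`"), the entries of `PMQ`
in rows `< d'` and columns `≥ l'` are coordinates of `t(MQeⱼ) = 0`. Port of the complex-case
`Literature.Barriers.Schanuel.isBlockCouple_of_rationalMap`.
[cite: Roy1992, §4 proof of Corollary 1 (p. 38)] -/
theorem isBlockCouple_of_rationalMap (M : Matrix (Fin d) (Fin l) (PadicAlgCl p)) {d' : ℕ}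
    (hd' : 0 < d') (t : (Fin d → PadicAlgCl p) →ₗ[PadicAlgCl p] (Fin d' → PadicAlgCl p))
    (ht : Function.Surjective t) (hrat : IsRationalMap t) :
    IsBlockCouple M d'
      (finrank (padicQbar p)
        ((Submodule.span (padicQbar p) (Set.range M.col)).map
          (t.restrictScalars (padicQbar p)))) := by
  set Qb := padicQbar p
  set l' := finrank Qb ((Submodule.span Qb (Set.range M.col)).map (t.restrictScalars Qb))
    with hl'def
  -- the matrix of `t`, with entries in `ℚ̄`
  set T : Matrix (Fin d') (Fin d) (PadicAlgCl p) := LinearMap.toMatrix' t with hTdef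
  let T₀ : Matrix (Fin d') (Fin d) Qb := fun i k => ⟨T i k, toMatrix'_mem_of_isRationalMap hrat i k⟩
  have hT₀ : ∀ i k, (T₀ i k : PadicAlgCl p) = T i k := fun i k => rfl
  -- `d' ≤ d` and the rows of `T` are independent (rank `T = d'`)
  have hd'd : d' ≤ d := by
    simpa using LinearMap.finrank_le_finrank_of_surjective ht
  have hrankT : T.rank = d' := by
    have h1 : T.rank = finrank (PadicAlgCl p) (LinearMap.range t) := by
      rw [Matrix.rank, hTdef, ← Matrix.toLin'_apply', Matrix.toLin'_toMatrix']
    rw [h1, LinearMap.range_eq_top.2 ht, finrank_top, finrank_fin_fun]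
  have hrowsC : LinearIndependent (PadicAlgCl p) T.row := by
    rw [linearIndependent_iff_card_eq_finrank_span, Fintype.card_fin, Set.finrank,
      ← Matrix.rank_eq_finrank_span_row, hrankT]
  have hrowsQ : LinearIndependent Qb (fun i => T₀ i) := by
    rw [Fintype.linearIndependent_iff]
    intro c hc i
    have hc' : ∑ i, (c i : PadicAlgCl p) • T.row i = 0 := by
      funext k
      have hk := congrArg (fun x : Qb => (x : PadicAlgCl p)) (congrFun hc k)
      simp only [Finset.sum_apply, Pi.smul_apply, Pi.zero_apply] at hk ⊢
      push_cast at hk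
      simpa [hT₀, smul_eq_mul, Matrix.row] using hk
    have h0 := Fintype.linearIndependent_iff.1 hrowsC (fun i => (c i : PadicAlgCl p)) hc' i
    exact_mod_cast h0
  obtain ⟨P, hP, hProws⟩ := _root_.Literature.Barriers.Schanuel.exists_isUnit_rows_eq _ hrowsQ
  -- the kernel of `c ↦ ∑ c_j t(M.col j)` on `ℚ̄^l` has dimension `l - l'`
  let ψ : (Fin l → Qb) →ₗ[Qb] (Fin d' → PadicAlgCl p) :=
    Fintype.linearCombination Qb fun j => t (M.col j)
  have hψrange : finrank Qb (LinearMap.range ψ) = l' := by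
    rw [hl'def, map_span_col_eq, Fintype.range_linearCombination]
  have hker : finrank Qb (LinearMap.ker ψ) = l - l' := by
    have h := LinearMap.finrank_range_add_finrank_ker ψ
    rw [hψrange, finrank_fin_fun] at h
    omega
  obtain ⟨Q, hQ, hQcols⟩ := _root_.Literature.Barriers.Schanuel.exists_isUnit_cols_mem _ hker
  have hl'l : l' ≤ l := by
    rw [hl'def, map_span_col_eq]
    have h := finrank_range_le_card (R := Qb) fun j => t (M.col j)
    rw [Fintype.card_fin] at h
    exact h
  refine ⟨hd', hd'd, hl'l, P, Q, hP, hQ, ?_⟩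
  intro i j hi hj
  -- column `j` of `M Q'` is killed by `t`
  set Q' : Matrix (Fin l) (Fin l) (PadicAlgCl p) := Q.map (algebraMap Qb (PadicAlgCl p)) with hQ'
  have hcolker : t ((M * Q').col j) = 0 := by
    have hmem : (fun k => Q k j) ∈ LinearMap.ker ψ := hQcols j (by omega)
    rw [LinearMap.mem_ker, Fintype.linearCombination_apply] at hmem
    have hcol : (M * Q').col j = ∑ k, Q k j • M.col k := by
      funext m
      simp [hQ', Matrix.col_apply, Matrix.mul_apply, Finset.sum_apply, Pi.smul_apply,
        IntermediateField.smul_def, smul_eq_mul, mul_comm]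
    rw [hcol, map_sum]
    simpa using hmem
  -- entry `(i, j)` of `P' (M Q')` is the `i`-th coordinate of `t` of that column
  have hPi : ∀ m, (P.map (algebraMap Qb (PadicAlgCl p))) i m = T ⟨i, hi⟩ m := by
    intro m
    rw [Matrix.map_apply, hProws i hi]
    rfl
  calc (P.map (algebraMap Qb (PadicAlgCl p)) * M * Q') i j
      = ∑ m, T ⟨i, hi⟩ m * (M * Q') m j := by
        rw [Matrix.mul_assoc, Matrix.mul_apply]
        exact Finset.sum_congr rfl fun m _ => by rw [hPi]
    _ = (T.mulVec ((M * Q').col j)) ⟨i, hi⟩ := by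
        simp [Matrix.mulVec, dotProduct, Matrix.col_apply]
    _ = t ((M * Q').col j) ⟨i, hi⟩ := by rw [hTdef, LinearMap.toMatrix'_mulVec]
    _ = 0 := by rw [hcolker]; rfl

end Block

end RoyPadic

/-! ### Corollary 1 from Theorem 4, and Corollary 2 from Theorem 4 -/

section CorOne

open RoyPadic

variable (p : ℕ) [Fact p.Prime]

/-- **Roy 1992, §4 Corollary 1 for `K = ℚ̄_p` PROVED from Theorem 4**
(`roy1992_padic_thm4 p → roy1992_padic_cor1 p`), following the printed proof: with `Z = φ(ℚ̄^l)`,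
`U = φ(K^l)` (`dim_K U = rank M = n`) and a minimising rational surjection `t`
(`RoyPadic.exists_minimal_rationalMap`), Theorem 4 gives `l'/(d' + l') ≤ dim U'/d' ≤ n/d`, i.e.
`n ≥ l'd/(d' + l')` (7); the base change (`RoyPadic.isBlockCouple_of_rationalMap`) gives
`θ̃(M) ≤ l'/d'`, and `x ↦ xd/(1 + x)` is increasing. Port of the complex-case
`Literature.Barriers.Schanuel.roy1992_cor1_of_thm4`.
[cite: Roy1992, §4 Corollary 1 and its proof (p. 38)] -/
theorem roy1992_padic_cor1_of_thm4 (h4 : roy1992_padic_thm4 p) : roy1992_padic_cor1 p := by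
  intro d l M hd hl hM
  obtain ⟨d', t, ht, hrat, hne, hmin⟩ :=
    exists_minimal_rationalMap hd (Submodule.span (PadicAlgCl p) (Set.range M.col))
  have hd'0 : 0 < d' := pos_of_ne_zero hne
  obtain ⟨h1, h2⟩ := h4 d hd (Submodule.span (padicQbar p) (Set.range M.col))
    (Submodule.span (PadicAlgCl p) (Set.range M.col)) (finite_span_col M)
    (fun z hz i => mem_logLinearForms_of_mem_span_col hM hz i) (span_col_le_restrictScalars M)
    d' t ht hrat hne hmin
  set l' := finrank (padicQbar p) ((Submodule.span (padicQbar p) (Set.range M.col)).map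
    (t.restrictScalars (padicQbar p))) with hl'
  set a := finrank (PadicAlgCl p) ((Submodule.span (PadicAlgCl p) (Set.range M.col)).map t)
    with ha
  rw [finrank_span_col] at h2
  have hblock : IsBlockCouple M d' l' := isBlockCouple_of_rationalMap M hd'0 t ht hrat
  have hθ : thetaBar M ≤ (l' : ℝ) / (d' : ℝ) := thetaBar_le_div hblock
  have hθ0 : 0 ≤ thetaBar M := thetaBar_nonneg M hd
  have hdR : (0 : ℝ) < d := by exact_mod_cast hd
  have hd'R : (0 : ℝ) < d' := by exact_mod_cast hd'0
  -- `θ̃ d/(1+θ̃) ≤ (l'/d') d / (1 + l'/d') = l' d/(d' + l') ≤ n`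
  calc thetaBar M * d / (1 + thetaBar M)
      ≤ (l' : ℝ) / d' * d / (1 + (l' : ℝ) / d') :=
        Literature.Barriers.Schanuel.mul_div_one_add_mono hθ0 hθ hdR.le
    _ = (l' : ℝ) / (d' + l') * d := by
        field_simp
    _ ≤ (a : ℝ) / d' * d := by
        exact mul_le_mul_of_nonneg_right h1 hdR.le
    _ ≤ (M.rank : ℝ) / d * d := by
        exact mul_le_mul_of_nonneg_right h2 hdR.le
    _ = M.rank := by field_simp

/-- **Roy 1992, §4 Corollary 2 for `K = ℚ̄_p` (the `p`-adic strong six exponentials theorem) from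
Theorem 4**: the composite of `roy1992_padic_cor1_of_thm4` with the tree's
`roy1992_padic_strongSixExponentials_of_cor1`; what remains un-discharged below it is Theorem 4 for
`ℚ̄_p` (`roy1992_padic_thm4`), i.e. Roy's Theorem 2 and M. Waldschmidt's Theorem 1 over `ℂ_p`.
[cite: Roy1992, §4 Corollary 2 and its proof (p. 38)] -/
theorem roy1992_padic_strongSixExponentials_of_thm4 (h4 : roy1992_padic_thm4 p)
    (M : Matrix (Fin 2) (Fin 3) (PadicAlgCl p)) (hM : ∀ i j, M i j ∈ logLinearForms p)
    (hrows : LinearIndependent (padicQbar p) (fun i => M i))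
    (hcols : LinearIndependent (padicQbar p) (fun j => M.transpose j)) : M.rank = 2 :=
  roy1992_padic_strongSixExponentials_of_cor1 p (roy1992_padic_cor1_of_thm4 p h4) M hM hrows hcols

end CorOne

end Literature.NumberTheory.Transcendental
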